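import Summits.RiemannHypothesis.RiemannHypothesis.Theorems.TiltedLandingLaw421R3RateBooksQ2

/-! # TiltedLandingLaw421R3RateBooksQ3 — W-08 RATE^B BOOKS: §B.7–§B.8

Continuation of `…R3RateBooksQ2.lean` (C4 g28 rateBooksQ-v5 sha c107456c, split per gate lint ≤ 400 l).
§B.7 deficit form; §B.8 Im²-weighted meters.
RH NOT proved; 24774 OPEN. -/

namespace RhW08.SealSwapQ

open Complex
open RhIdea6.G17.W07C7 RhIdea6.G17.W07C7.Rev6 RhIdea6.G18.W07C8.Law421BirthS RhIdea6.G19.W07C11.Seam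
open RhIdea6.G20.W07C12.Frac RhIdea6.G20.W07C12.StColP RhW07.C12.FieldSplit RhIdea6.G21.W07C13.TentMax
open RhW07.C14.TwoSided RhW07.C14.Classes RhW07.C14.Lineage RhW07.C14.Booking
open RhW07.C13.Heredity RhIdea6.G22.W07C15pre.Injection RhW07.E3.Cell
open RhW07.E3.Lit
open RhW08.Round1 RhW08.StSwap RhW08.Round2 RhW08.QuadW
open RhW08.SealSwap (PBot)

open Classical in
/-- §B.7 the per-level DEFICIT of a potential `Φ` on the class `𝓚`: how much the step `Φ k → Φ (k+1)` falls short of paying the drop-netted charge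
`[Ch k ∧ 𝓚 k]·(1 − 4·dropQ k/s)` (positive part; a rise of `Φ` off the class is a deficit too). -/
noncomputable def deficitQ (Φ : LevelMeter) (𝓚 : LevelClass) : LevelMeter := fun η f x₀ s hmax R Hs B k =>
  max (Φ η f x₀ s hmax R Hs B (k + 1) - Φ η f x₀ s hmax R Hs B k
        + (if Charged (PTrkSQ PBot) StTrkDQ ReadyR2 η f x₀ s hmax R Hs B k ∧ 𝓚 η f x₀ s hmax R Hs B k
            then 1 - 4 * dropQ η f x₀ s hmax R Hs B k / s else 0)) 0

/-- §B.7 DEFICIT LAW SHAPE: the accumulated deficits of `Φ` on `𝓚` stay within `aR` (checked after every charged level). -/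
def DeficitLawQ (Φ : LevelMeter) (𝓚 : LevelClass) (aR : Budget) : Prop :=
  ∀ (η : ℝ) (f : ℂ → ℂ) (x₀ s hmax R Hs : ℝ) (B : ℕ), EngineHyps5 2 η f x₀ s hmax R Hs B →
    ∀ k : ℕ, Charged (PTrkSQ PBot) StTrkDQ ReadyR2 η f x₀ s hmax R Hs B k →
      prefixSumQ (deficitQ Φ 𝓚) η f x₀ s hmax R Hs B (k + 1) ≤ aR η f x₀ s hmax R Hs B

/-- §B.7 the level-0 value of a meter, as an allowance. -/
def purseOfQ (Φ : LevelMeter) : Budget := fun η f x₀ s hmax R Hs B => Φ η f x₀ s hmax R Hs B 0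

/-- §B.7 non-negativity of a meter on legal data. -/
def NonnegMeterQ (Φ : LevelMeter) : Prop :=
  ∀ (η : ℝ) (f : ℂ → ℂ) (x₀ s hmax R Hs : ℝ) (B : ℕ), EngineHyps5 2 η f x₀ s hmax R Hs B → ∀ k : ℕ, 0 ≤ Φ η f x₀ s hmax R Hs B k

open Classical in
/-- ★★★ (K) §B.7 **DEFICIT FORM**: a non-negative potential `Φ` whose accumulated deficit on `𝓚` stays within `aR` gives `ClassLawQ 𝓚 (Φ 0 + aR)`.
Every candidate payer (Jensen energies, cluster strip energies, field meters …) enters the books through this one door; engines report the single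
number `prefixSumQ (deficitQ Φ 𝓚)` at the last charged level per legal frame. -/
theorem classLawQ_of_deficitLaw {𝓚 : LevelClass} {aR : Budget} (Φ : LevelMeter) (hΦ : NonnegMeterQ Φ) (hd : DeficitLawQ Φ 𝓚 aR) :
    ClassLawQ 𝓚 (addBudget (purseOfQ Φ) aR) := by
  refine classLawQ_of_potential_rises Φ (deficitQ Φ 𝓚) ?_
  intro η f x₀ s hmax R Hs B hE
  refine ⟨hΦ η f x₀ s hmax R Hs B hE, le_of_eq rfl, fun k hk => hd η f x₀ s hmax R Hs B hE k hk, ?_⟩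
  intro k _
  have := le_max_left (Φ η f x₀ s hmax R Hs B (k + 1) - Φ η f x₀ s hmax R Hs B k
        + (if Charged (PTrkSQ PBot) StTrkDQ ReadyR2 η f x₀ s hmax R Hs B k ∧ 𝓚 η f x₀ s hmax R Hs B k
            then 1 - 4 * dropQ η f x₀ s hmax R Hs B k / s else 0)) 0
  simp only [deficitQ]
  linarith

/-- §B.7 the zero meter. -/
def zeroMeterQ : LevelMeter := fun _ _ _ _ _ _ _ _ _ => 0

open Classical in
/-- (K) §B.7 with the ZERO potential the deficit is the POSITIVE PART of the drop-netted charge: `deficitQ 0 𝓚 k = [Ch k ∧ 𝓚 k]·(1 − 4·dropQ k/s)⁺`. -/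
theorem deficitQ_zeroMeter (𝓚 : LevelClass) (η : ℝ) (f : ℂ → ℂ) (x₀ s hmax R Hs : ℝ) (B k : ℕ) :
    deficitQ zeroMeterQ 𝓚 η f x₀ s hmax R Hs B k
      = if Charged (PTrkSQ PBot) StTrkDQ ReadyR2 η f x₀ s hmax R Hs B k ∧ 𝓚 η f x₀ s hmax R Hs B k
          then max (1 - 4 * dropQ η f x₀ s hmax R Hs B k / s) 0 else 0 := by
  unfold deficitQ zeroMeterQ
  split_ifs <;> simp

/-- (T, OPEN) §B.7 **C1's wording of (P4)** (HANDOVER 08:43Z): the POSITIVE-PART drop-netted count of the approach levels,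
`Σ_{j ≤ k, Ch j ∧ Approach j} (1 − 4·drop_j/s)⁺ ≤ aA` — a deficit law with the zero potential. -/
def ApproachPosPartLawQ (aA : Budget) : Prop := DeficitLawQ zeroMeterQ ApproachLevelQ aA

/-- ★ (K) §B.7 C1's positive-part wording implies the books-side (P4) (with the same allowance). -/
theorem approachAllowanceQ_of_posPart {aA : Budget} (h : ApproachPosPartLawQ aA) : ApproachAllowanceQ aA := by
  have h1 : ClassLawQ ApproachLevelQ (addBudget (purseOfQ zeroMeterQ) aA) :=
    classLawQ_of_deficitLaw zeroMeterQ (fun _ _ _ _ _ _ _ _ _ _ => le_rfl) h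
  intro η f x₀ s hmax R Hs B hE k hk
  have := h1 η f x₀ s hmax R Hs B hE k hk
  simpa [addBudget, purseOfQ, zeroMeterQ] using this

/-- (K) §B.7 a class law is a credit law (credits are non-negative). -/
theorem creditLawQ_of_classLawQ {𝓚 : LevelClass} {a : Budget} (h : ClassLawQ 𝓚 a) : CreditLawQ 𝓚 a := by
  intro η f x₀ s hmax R Hs B hE k hk
  have := h η f x₀ s hmax R Hs B hE k hk
  linarith [creditsQ_nonneg η f x₀ s hmax R Hs B (k + 1)]

/-- ★ (K) §B.7 **credit laws refine too**: a credit law on `𝓚₁` and a class law on `𝓚₂ ∖ 𝓚₁` give a credit law on `𝓚₁ ∪ 𝓚₂` — so the consumption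
class may be split into «consuming» (credits pay) ∪ «cluster hover» (a strip-energy deficit law pays, C6 ADD-116) inside the same socket. -/
theorem creditLawQ_union {𝓚₁ 𝓚₂ : LevelClass} {a₁ a₂ : Budget}
    (h₁ : CreditLawQ 𝓚₁ a₁) (h₂ : ClassLawQ (diffClass 𝓚₂ 𝓚₁) a₂) : CreditLawQ (unionClass 𝓚₁ 𝓚₂) (addBudget a₁ a₂) := by
  intro η f x₀ s hmax R Hs B hE k hk
  rw [netCostQ_union, addBudget]
  have := h₁ η f x₀ s hmax R Hs B hE k hk
  have := h₂ η f x₀ s hmax R Hs B hE k hk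
  linarith

/-- (K) §B.7 credit laws transfer along pointwise-equivalent classes. -/
theorem creditLawQ_congr {𝓚₁ 𝓚₂ : LevelClass} {a : Budget}
    (heq : ∀ (η : ℝ) (f : ℂ → ℂ) (x₀ s hmax R Hs : ℝ) (B j : ℕ), 𝓚₁ η f x₀ s hmax R Hs B j ↔ 𝓚₂ η f x₀ s hmax R Hs B j)
    (h : CreditLawQ 𝓚₁ a) : CreditLawQ 𝓚₂ a := by
  have hfun : 𝓚₂ = 𝓚₁ := by
    funext η f x₀ s hmax R Hs B j
    exact propext (heq η f x₀ s hmax R Hs B j).symm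
  subst hfun
  exact h

/-! ## §B.8 Im²-weighted METERS on a FIXED region (C1 HANDOVER «tentEnergy twin of tentCount», C6 ADD-116 strip energy) -/

/-- §B.8 the UPPER zero box of `g` over the real-part region `I`, heights in `(0, H]`. A bounded box meets the zero set of a non-identically-zero
entire function in a finite set, so the finsums below are genuine sums there (junk `0` only if `g ≡ 0` near the box). -/
def upperZeroBox (g : ℂ → ℂ) (I : Set ℝ) (H : ℝ) : Set ℂ := {z : ℂ | g z = 0 ∧ z.re ∈ I ∧ 0 < z.im ∧ z.im ≤ H}

/-- §B.8 **BOX ENERGY** `E(g; I, H) := Σ_{upper zeros z of g, Re z ∈ I, Im z ≤ H} mult(z)·(Im z)²` — the Im²-weighted twin of the strip / tent counts. -/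
noncomputable def boxEnergy (g : ℂ → ℂ) (I : Set ℝ) (H : ℝ) : ℝ :=
  ∑ᶠ z ∈ upperZeroBox g I H, ((analyticOrderAt g z).toNat : ℝ) * z.im ^ 2

/-- §B.8 **BOX PAIR COUNT** `N(g; I, H) := Σ_{upper zeros, same box} mult(z)` (number of conjugate pairs over `I` up to height `H`). -/
noncomputable def boxPairs (g : ℂ → ℂ) (I : Set ℝ) (H : ℝ) : ℝ :=
  ∑ᶠ z ∈ upperZeroBox g I H, ((analyticOrderAt g z).toNat : ℝ)

/-- (K) §B.8 the box energy is non-negative. -/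
theorem boxEnergy_nonneg (g : ℂ → ℂ) (I : Set ℝ) (H : ℝ) : 0 ≤ boxEnergy g I H :=
  finsum_nonneg fun _ => finsum_nonneg fun _ => mul_nonneg (Nat.cast_nonneg _) (sq_nonneg _)

/-- (K) §B.8 the weighted pair count of a box is non-negative. -/
theorem boxPairs_nonneg (g : ℂ → ℂ) (I : Set ℝ) (H : ℝ) : 0 ≤ boxPairs g I H :=
  finsum_nonneg fun _ => finsum_nonneg fun _ => Nat.cast_nonneg _

/-- (K) §B.8 on a finite box the energy is at most `H²` per pair. -/
theorem boxEnergy_le_sq_mul_boxPairs (g : ℂ → ℂ) (I : Set ℝ) {H : ℝ} (hfin : (upperZeroBox g I H).Finite) :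
    boxEnergy g I H ≤ H ^ 2 * boxPairs g I H := by
  unfold boxEnergy boxPairs
  rw [finsum_mem_eq_finite_toFinset_sum _ hfin, finsum_mem_eq_finite_toFinset_sum _ hfin, Finset.mul_sum]
  refine Finset.sum_le_sum fun z hz => ?_
  have hz' : z ∈ upperZeroBox g I H := by simpa using hz
  have h1 : z.im ^ 2 ≤ H ^ 2 := pow_le_pow_left₀ hz'.2.2.1.le hz'.2.2.2 2
  have h0 : (0 : ℝ) ≤ ((analyticOrderAt g z).toNat : ℝ) := Nat.cast_nonneg _
  nlinarith

/-- §B.8 the FIXED INITIAL REGION of a frame (real parts): the `R/2`-column about `x₀` together with the `3/2`-strips of the level-0 lowest band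
states (union over all of them — no tie rule needed). It does NOT move with the level (lessons ADD-109/110). -/
def initRegionQ (η : ℝ) (f : ℂ → ℂ) (x₀ s hmax R Hs : ℝ) (B : ℕ) : Set ℝ :=
  {x : ℝ | |x - x₀| ≤ R / 2} ∪ ⋃ u₀ ∈ {u : ℂ | IsLowest StTrkDQ η f x₀ s hmax R Hs B 0 u}, {x : ℝ | |x - u₀.re| ≤ 3 / 2 * u₀.im}

/-- §B.8 the FIXED-REGION ENERGY meter `E_j := E(f⁽ʲ⁾; initRegion, Hs)`. -/
noncomputable def fixedEnergyQ : LevelMeter := fun η f x₀ s hmax R Hs B j =>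
  boxEnergy (iteratedDeriv j f) (initRegionQ η f x₀ s hmax R Hs B) Hs

/-- §B.8 the FIXED-REGION PAIR COUNT meter `N_j := N(f⁽ʲ⁾; initRegion, Hs)` (C1's consumption signal: `N` drops). -/
noncomputable def fixedPairsQ : LevelMeter := fun η f x₀ s hmax R Hs B j =>
  boxPairs (iteratedDeriv j f) (initRegionQ η f x₀ s hmax R Hs B) Hs

/-- §B.8 the scaled ENERGY POTENTIAL `Φ_j := η²·E_j/s²`. -/
noncomputable def energyPotQ : LevelMeter := fun η f x₀ s hmax R Hs B j => η ^ 2 * fixedEnergyQ η f x₀ s hmax R Hs B j / s ^ 2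

/-- (K) §B.8 the energy potential is non-negative. -/
theorem energyPotQ_nonneg : NonnegMeterQ energyPotQ := by
  intro η f x₀ s hmax R Hs B _ k
  unfold energyPotQ fixedEnergyQ
  exact div_nonneg (mul_nonneg (sq_nonneg _) (boxEnergy_nonneg _ _ _)) (sq_nonneg _)

/-- (T, OPEN) §B.8 **STRIP-ENERGY DEFICIT LAW on a class `𝓚`** (C6 ADD-116 / C1 HANDOVER, in the books' currency): the accumulated deficit of
`Φ_j = η²E_j/s²` against the drop-netted charges of the `𝓚`-levels stays within `aR` (entries into the fixed box and member rises are the deficits;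
C6 measured the un-netted step `(η/s)²(E_j − E_{j+1}) ≥ 1` failing on 6/450 tented legal levels, all ENTRY events). -/
def EnergyDeficitLawQ (𝓚 : LevelClass) (aR : Budget) : Prop := DeficitLawQ energyPotQ 𝓚 aR

/-- ★★ (K) §B.8 the strip-energy deficit law on `𝓚` gives `ClassLawQ 𝓚 (η²E₀/s² + aR)`. -/
theorem classLawQ_of_energyDeficit {𝓚 : LevelClass} {aR : Budget} (h : EnergyDeficitLawQ 𝓚 aR) :
    ClassLawQ 𝓚 (addBudget (purseOfQ energyPotQ) aR) :=
  classLawQ_of_deficitLaw energyPotQ energyPotQ_nonneg h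

/-- ★★ (K) §B.8 **C6's refinement inside (CA364)**: split the consumption class `𝓒 ∖ 𝓕` into «consuming» levels `𝓓` (credits + `aC` pay) and the
rest (the strip-energy deficit law pays); the union is again ONE credit law for the socket's middle slot. -/
theorem consLawQ_of_split {𝓓 : LevelClass} {aC aR : Budget}
    (hD : CreditLawQ 𝓓 aC)
    (hE : EnergyDeficitLawQ (diffClass (diffClass ConsLevelQ FarLevelQ) 𝓓) aR) :
    CreditLawQ (unionClass 𝓓 (diffClass ConsLevelQ FarLevelQ)) (addBudget aC (addBudget (purseOfQ energyPotQ) aR)) :=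
  creditLawQ_union hD (classLawQ_of_energyDeficit hE)

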